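/-
Copyright: the b2b-balaban T⁴-continuum CRUX team, row NE7b OWNER lineage `t4-ne7b-p1` (gen 131). Project licence.
-/
import Summits.QuantumFields.BalabanUV.T4Continuum.Spine.NE7b.SupPolymerLocalGas
import Literature.Probability.LatticeModels.PolymerPushforward
import Literature.Probability.LatticeModels.LocalPerturbationClusterExpansion

/-!
# RESUMMATION BY UNIONS — THE POLYMER-LOCAL GAS IS A GAS OF CONNECTED CELL SETS: (348)'s hard-core gas of touch-connected FAMILIES of cell
# sets (incompatibility: equal or touching families) pushes forward along the union map `𝒜 ↦ ⋃𝒜` to the road's own format — the gas of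
# CELL SETS with the geometric incompatibility `GeomInc R` and the resummed activity `z(Y) = Σ_{𝒜 : ⋃𝒜 = Y} M(𝒜)`:
#   `Ξ^{families}(𝒫(𝒳); M) = Ξ^{GeomInc R}(⋃-image; ⋃_* M)`  (the tree's `polymerPartitionFunction_pushforward`: two distinct families with
# the same union share a cell, hence are incompatible; families with different unions are incompatible iff their unions touch), and when
# the members of `𝒳` are `R`-connected every polymer of the image is an `R`-CONNECTED cell set — so (287)'s BOUNDED-DEGREE Kotecký–Preiss
# layer (cells have `≤ Δ` neighbours) applies to the polymer-local input class once the resummed activity is small like `ε′^{#Y}` (the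
# cover-counting bound, the successor's): SCOPING-d5 (3b) corrected — no weighted KP criterion is needed after resummation
# (row NE7b, node U5c; (348) + the tree's `PolymerPushforward` BY NAME; [folklore])

Cell `pub-balaban`, sub-cell `t4`, spine estimate NE7b (`T4WeightBudget.RelWeightBound`; the cell's OWN estimate — NOT PRINTED in
[Bałaban 1983–89], NOT PROVED).  Crux-route work under `Spine/NE7b/` by the row OWNER (`t4-ne7b-p1` gen 131, file (349)) under FREEZE
(0)'s crux-prover clause, on `g131/records/SCOPING-d5-reentry.md` DECISION (2)–(3); NOTHING of Bałaban's is named as a Lean object,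
valued or asserted; no `T4Continuum/Support` leaf typed; no `def`, no notation; zero `sorry`.  Imports (BY NAME): the OWNER's (348)
`…SupPolymerLocalGas` (`touches_symm`); the tree's `PolymerPushforward.polymerPartitionFunction_pushforward`, `pushforwardActivity`,
`LocalPerturbationClusterExpansion.instReflGeomInc ∕ instSymmGeomInc`, `IsRConnected`, `rconnSubsets`, `mem_rconnSubsets`.

WHAT IS PROVED ([folklore]; `𝒫(𝒳) = rconnSubsets (Touches R) 𝒳` = the nonempty touch-connected subfamilies of `𝒳`):
* §1 `biUnion_nonempty_of_mem` (a polymer family has a nonempty union when `∅ ∉ 𝒳`), `geomInc_families_of_union_eq` (THE FIBRES ARE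
  CLIQUES: same union ⟹ incompatible), `geomInc_families_iff_unions` (different unions: incompatible iff the unions are `GeomInc R`),
  **`isRConnected_biUnion_of_touchConnected`** (a touch-connected family of `R`-connected sets has an `R`-connected union);
* §2 THE END **`polymerLocal_resummation`** (`Ξ^{GeomInc (Touches R)}(𝒫(𝒳); M) = Ξ^{GeomInc R}((𝒫(𝒳)).image ⋃; ⋃_* M)`) and
  `image_biUnion_subset_rconn` (every polymer of the image is an `R`-connected subset of `⋃𝒳`); §3 toy.

HONEST (what this is NOT).  Exact combinatorics; the smallness of the resummed activity (`|⋃_*M(Y)| ≤ Σ_{covers}∏ε^{#X} ≤ (√ε·e^{C√ε})^{#Y}`,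
a lattice-animal count) and then (287)∕(289)∕(296)'s bounds for the polymer-local input are the successor's; scalar skeleton ((A3),
NC-NE7b-α UNRULED); nothing of Bałaban's asserted.  BY-NAME EFFECT ON THE WALL: NONE.  NE7b NOT PRINTED ∕ NOT PROVED; spine PROVED 0∕9; rung
(B)+1 — the programme's measures remain FINITE-torus statements; NOT the mass gap, NOT Clay.  HONEST DEPENDENCY: continuum YM on T⁴ ⇐
BetaPertH ∧ nine spine estimates (0∕9 proved); BetaPertH ⇐ (D1) ∧ (D4) ∧ CAP+tail; G-an2-4 gates asym, D1 and NE2∕3∕4.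
-/

set_option autoImplicit false

noncomputable section

namespace Summit.QuantumFields.BalabanUV.T4Continuum.NE7b.SupPolymerLocalResummation

open Finset
open scoped BigOperators
open Literature.Probability.LatticeModels
open SupPolymerLocalGas (touches_symm)

variable {V : Type*} [DecidableEq V] {R : V → V → Prop}

/-! ## §1. Fibres are cliques; incompatibility is read on the unions; unions are connected -/

/-- A nonempty family of nonempty sets has a nonempty union. [folklore] -/
theorem biUnion_nonempty_of_mem {𝒜 : Finset (Finset V)} (h𝒜 : 𝒜.Nonempty) (hne : ∀ X ∈ 𝒜, X.Nonempty) :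
    (𝒜.biUnion id).Nonempty := by
  obtain ⟨X, hX⟩ := h𝒜
  obtain ⟨x, hx⟩ := hne X hX
  exact ⟨x, mem_biUnion.2 ⟨X, hX, hx⟩⟩

/-- **THE FIBRES OF THE UNION MAP ARE CLIQUES**: two nonempty families of nonempty sets with the same union are equal or touch as
families (some member of one shares a cell with some member of the other). [folklore] -/
theorem geomInc_families_of_union_eq {𝒜₁ 𝒜₂ : Finset (Finset V)} (h₁ : 𝒜₁.Nonempty) (hne₁ : ∀ X ∈ 𝒜₁, X.Nonempty)
    (hU : 𝒜₁.biUnion id = 𝒜₂.biUnion id) : GeomInc (Touches R) 𝒜₁ 𝒜₂ := by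
  obtain ⟨x, hx⟩ := biUnion_nonempty_of_mem h₁ hne₁
  obtain ⟨X, hX, hxX⟩ := mem_biUnion.1 hx
  rw [hU] at hx
  obtain ⟨Y, hY, hxY⟩ := mem_biUnion.1 hx
  exact Or.inr ⟨X, hX, Y, hY, Or.inr ⟨x, hxX, x, hxY, Or.inl rfl⟩⟩

/-- **INCOMPATIBILITY IS READ ON THE UNIONS**: for families of nonempty sets with DIFFERENT unions, equal-or-touching as families ⟺
the unions are geometrically incompatible (`GeomInc R`). [folklore] -/
theorem geomInc_families_iff_unions {𝒜₁ 𝒜₂ : Finset (Finset V)} (hne₁ : ∀ X ∈ 𝒜₁, X.Nonempty)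
    (hU : 𝒜₁.biUnion id ≠ 𝒜₂.biUnion id) :
    GeomInc (Touches R) 𝒜₁ 𝒜₂ ↔ GeomInc R (𝒜₁.biUnion id) (𝒜₂.biUnion id) := by
  constructor
  · rintro (heq | ⟨X, hX, Y, hY, hXY⟩)
    · exact absurd (heq ▸ rfl) hU
    · refine Or.inr ?_
      rcases hXY with rfl | ⟨w, hw, q, hq, hwq⟩
      · obtain ⟨x, hx⟩ := hne₁ X hX
        exact ⟨x, mem_biUnion.2 ⟨X, hX, hx⟩, x, mem_biUnion.2 ⟨X, hY, hx⟩, Or.inl rfl⟩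
      · exact ⟨w, mem_biUnion.2 ⟨X, hX, hw⟩, q, mem_biUnion.2 ⟨Y, hY, hq⟩, hwq⟩
  · rintro (heq | ⟨w, hw, q, hq, hwq⟩)
    · exact absurd heq hU
    · obtain ⟨X, hX, hwX⟩ := mem_biUnion.1 hw
      obtain ⟨Y, hY, hqY⟩ := mem_biUnion.1 hq
      exact Or.inr ⟨X, hX, Y, hY, Or.inr ⟨w, hwX, q, hqY, hwq⟩⟩

omit [DecidableEq V] in
/-- Reachability inside a member lifts to reachability inside any superset. [folklore] -/
theorem reach_mono {X U : Finset V} (hXU : X ⊆ U) {v w : V} (h : Relation.ReflTransGen (fun x y => R x y ∧ x ∈ X ∧ y ∈ X) v w) :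
    Relation.ReflTransGen (fun x y => R x y ∧ x ∈ U ∧ y ∈ U) v w :=
  (Relation.ReflTransGen.mono (r := fun x y => R x y ∧ x ∈ X ∧ y ∈ X) (p := fun x y => R x y ∧ x ∈ U ∧ y ∈ U)
    (fun _ _ h' => ⟨h'.1, hXU h'.2.1, hXU h'.2.2⟩)) v w h

/-- **A TOUCH-CONNECTED FAMILY OF `R`-CONNECTED SETS HAS AN `R`-CONNECTED UNION.** [folklore] -/
theorem isRConnected_biUnion_of_touchConnected {𝒜 : Finset (Finset V)} (h𝒜 : IsRConnected (Touches R) 𝒜)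
    (hconn : ∀ X ∈ 𝒜, IsRConnected R X) : IsRConnected R (𝒜.biUnion id) := by
  set U := 𝒜.biUnion id with hU
  have hsub : ∀ X ∈ 𝒜, X ⊆ U := fun X hX => subset_biUnion_of_mem id hX
  -- every cell of a member reachable from any cell of a touch-reachable member
  have key : ∀ X₁ X₂ : Finset V, Relation.ReflTransGen (fun A B => Touches R A B ∧ A ∈ 𝒜 ∧ B ∈ 𝒜) X₁ X₂ → X₁ ∈ 𝒜 →
      ∀ v ∈ X₁, ∀ w ∈ X₂, Relation.ReflTransGen (fun x y => R x y ∧ x ∈ U ∧ y ∈ U) v w := by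
    intro X₁ X₂ hpath hX₁
    induction hpath with
    | refl => exact fun v hv w hw => reach_mono (hsub X₁ hX₁) ((hconn X₁ hX₁).2 v hv w hw)
    | tail _ hBC ih =>
        obtain ⟨⟨a, ha, b, hb, hab⟩, hB, hC⟩ := hBC
        intro v hv w hw
        have h1 := ih v hv a ha
        have h2 : Relation.ReflTransGen (fun x y => R x y ∧ x ∈ U ∧ y ∈ U) a b := by
          rcases hab with rfl | hr
          · exact Relation.ReflTransGen.refl
          · exact Relation.ReflTransGen.single ⟨hr, hsub _ hB ha, hsub _ hC hb⟩
        have h3 := reach_mono (hsub _ hC) ((hconn _ hC).2 b hb w hw)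
        exact (h1.trans h2).trans h3
  refine ⟨?_, fun v hv w hw => ?_⟩
  · obtain ⟨X, hX⟩ := h𝒜.1
    obtain ⟨x, hx⟩ := (hconn X hX).1
    exact ⟨x, mem_biUnion.2 ⟨X, hX, hx⟩⟩
  · obtain ⟨X₁, hX₁, hv1⟩ := mem_biUnion.1 hv
    obtain ⟨X₂, hX₂, hw2⟩ := mem_biUnion.1 hw
    exact key X₁ X₂ (h𝒜.2 X₁ hX₁ X₂ hX₂) hX₁ v hv1 w hw2

/-! ## §2. THE END: resummation by unions -/

/-- **THE POLYMER-LOCAL GAS IS A GAS OF CELL SETS**: `R` symmetric and decidable, `∅ ∉ 𝒳` ⟹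
`Ξ^{GeomInc (Touches R)}(𝒫(𝒳); M) = Ξ^{GeomInc R}((𝒫(𝒳)).image ⋃; ⋃_* M)` with the resummed activity
`(⋃_* M)(Y) = Σ_{𝒜 ∈ 𝒫(𝒳), ⋃𝒜 = Y} M(𝒜)`. [folklore] -/
theorem polymerLocal_resummation [DecidableRel R] [Std.Symm R] (𝒳 : Finset (Finset V)) (h𝒳 : ∀ X ∈ 𝒳, X.Nonempty)
    (M : Finset (Finset V) → ℂ) :
    polymerPartitionFunction (GeomInc (Touches R)) M (rconnSubsets (Touches R) 𝒳) =
      polymerPartitionFunction (GeomInc R) (pushforwardActivity (fun 𝒜 : Finset (Finset V) => 𝒜.biUnion id) M (rconnSubsets (Touches R) 𝒳))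
        ((rconnSubsets (Touches R) 𝒳).image fun 𝒜 => 𝒜.biUnion id) := by
  haveI : Std.Symm (Touches R) := ⟨fun X Y h => touches_symm symm_of_inst X Y h⟩
  have hmem : ∀ 𝒜 ∈ rconnSubsets (Touches R) 𝒳, 𝒜.Nonempty ∧ ∀ X ∈ 𝒜, X.Nonempty := fun 𝒜 h𝒜 =>
    ⟨(mem_rconnSubsets.1 h𝒜).2.1, fun X hX => h𝒳 X ((mem_rconnSubsets.1 h𝒜).1 hX)⟩
  refine polymerPartitionFunction_pushforward (fun 𝒜 : Finset (Finset V) => 𝒜.biUnion id) M _ (fun 𝒜₁ h₁ 𝒜₂ _ hU => ?_)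
    (fun 𝒜₁ h₁ 𝒜₂ _ hU => ?_)
  · exact geomInc_families_of_union_eq (hmem 𝒜₁ h₁).1 (hmem 𝒜₁ h₁).2 hU
  · exact geomInc_families_iff_unions (hmem 𝒜₁ h₁).2 hU

/-- **Every polymer of the image is an `R`-connected subset of `⋃𝒳`** (members `R`-connected). [folklore] -/
theorem image_biUnion_subset_rconn [DecidableRel R] (𝒳 : Finset (Finset V)) (hconn : ∀ X ∈ 𝒳, IsRConnected R X) :
    ((rconnSubsets (Touches R) 𝒳).image fun 𝒜 => 𝒜.biUnion id) ⊆ rconnSubsets R (𝒳.biUnion id) := by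
  intro Y hY
  obtain ⟨𝒜, h𝒜, rfl⟩ := mem_image.1 hY
  obtain ⟨h𝒜𝒳, h𝒜c⟩ := mem_rconnSubsets.1 h𝒜
  refine mem_rconnSubsets.2 ⟨biUnion_subset_biUnion_of_subset_left id h𝒜𝒳, ?_⟩
  exact isRConnected_biUnion_of_touchConnected h𝒜c fun X hX => hconn X (h𝒜𝒳 hX)

/-! ## §3. Toy -/

/-- Toy (§1): the family `{{0}, {0,1}}` on `Fin 2` has the nonempty union `{0,1}`. -/
example : ((({{0}, {0, 1}} : Finset (Finset (Fin 2)))).biUnion id).Nonempty :=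
  biUnion_nonempty_of_mem ⟨{0}, by simp⟩ (fun X hX => by
    simp only [Finset.mem_insert, Finset.mem_singleton] at hX
    rcases hX with rfl | rfl <;> simp)

end Summit.QuantumFields.BalabanUV.T4Continuum.NE7b.SupPolymerLocalResummation
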